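/-
Copyright (c) 2026 the pub-hodgecm-mathlib formalisation cell (harness21).  Prover seat hodgecm-mathlib-K2Liu-p05 (g2), 2026-09-04
(Track B «K2-LIT», crux hLiu418 = stmt-HodgeConjecture-24832, organ (L24-c)∕(G3) of socket #24i∕#30i `sig_K2LiuThetaTypeSphericalEigenvalueInert`,
LEAD F0P6-plan (g11) deal 05:01:57Z (ii), LEAD BOX 05:10:24Z «(G3) on (Σ) GREEN»; (Σ) = ★ p857630 K2Liu-p01 (g4)).
-/
import Summits.HodgeConjecture.HodgeConjecture.Theorems.K2LiuThetaTypeSphericalEigenvalueInertOfUpstairs  -- ★ (this seat) #24i MODULO (Σ) + `hloc`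
import Summits.HodgeConjecture.HodgeConjecture.Theorems.K2LiuInertThetaSphericalEigenvalue               -- ★ (Σ) K2Liu-p01 (g4) `heckeOperator_unitVec_eq_smul_inert`
import Literature.NumberTheory.GaloisRepresentations.HeckeCharacterCofiniteProofs                        -- ★ `HeckeCharacter.isUnramifiedAt_cofinite_holds`
import HarnessLib

/-!
# (L24-c)∕(G3): SOCKET #24i `sig_K2LiuThetaTypeSphericalEigenvalueInert` PAID BY VALUE — the θ-type spherical eigenvalue at the good inert places, on `σ`

Topic: crux hLiu418 (stmt-HodgeConjecture-24832), Track B «K2-LIT», socket #24i∕#30i `sig_K2LiuThetaTypeSphericalEigenvalueInert`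
(`Cruxes/HLiu418/Lines/K2_Liu_CurveThetaSigs_U5e_InertSeam.lean` ED. 2 :258, tree 0af35c0e8c96fba5).  Namespace
`Summit.HodgeConjecture.HodgeConjecture.Cruxes.HLiu418.K2LiuThetaTypeSphericalEigenvalueInert`.  THEOREMS ONLY (no definition, no named fact, no
instance, no notation, no `sorry`); `--supports stmt-HodgeConjecture-24832 --as helper`; the tie `sig_K2LiuThetaTypeSphericalEigenvalueInert :=
thetaTypeSphericalEigenvalueInert …` is the typist's (U5e ED. 3).

THE STATEMENT.  `thetaTypeSphericalEigenvalueInert : ‹#24i :258–:302 VERBATIM›`: for the θ-block of ★ #30a at `H := diagonal dV` and every injective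
`j : σ ↪ ω⋆`, there is a finite `S₀` off which, at every inert unramified non-dyadic good `w ∣ v` with #28i's frame∕generator block (`ϖ`, `T ∈ GL₂(𝒪_w)`,
`t₁ = T⁻¹ diag(ϖ, ϖ⁻¹) T` at `w`) and every `K` hyperspecial at `v`, `heckeOperator σ K (ι_v t₁) y = (q(Z + Z⁻¹) + q − 1) • y` on `σ^K`,
`Z := (toHeckeCharacter L lam).valueAtUniformizer w.1`, `q := q_v`.

THE PROOF = ★ `thetaTypeSphericalEigenvalueInert_of_upstairs` (this seat: (L24-a) line ⇒ `hloc` ⇒ S4c-H global ⇒ pull-back along `j`) applied to the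
discharge `upstairs_inert` of its one hypothesis (Σ), obtained PLACE BY PLACE (`upstairs_inert_at`) from ★ (Σ) K2Liu-p01 (g4)
`K2LiuInertThetaSphericalEigenvalue.heckeOperator_unitVec_eq_smul_inert` (the UPSTAIRS Hecke computation on `1_{𝒪_v^{n′}}` for
`ω_v ∘ s_v ∘ localLineInl v`, `s_v = localSplittingCMWith … θ … μ`, eigenvalue in `θ_w(ϖ)`-currency, its `hline` = (L24-a) ★
`fixedPoints_omegaLoc_comp_localLineInl_localInt_eq_span_unitVec_inert`) through the two S-bridges of the LEAD BOX 05:10:24Z: (β2) SPLITTINGS — the S4c-H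
carrier's section at `v` is `localSplittingCM … θ … v` (★ `congrW_undoubledSplittings_cmFinLocalFamily_s`), definitionally `localSplittingCMWith … Measure.addHaar`
for the Borel σ-algebra (`rfl`); (β1) `Z`-CURRENCY — `θ_w(ϖ) = θ.valueAtUniformizer w` for `θ` unramified at `w` and `ϖ` a uniformizer (★
`HeckeCharacter.localComponent_eq_valueAtUniformizer`).  The finite exceptional set: the places over the finitely many `v` where one of the cofinite side
conditions fails — `2 ∈ 𝒪_v^×`, `imagUnit L` a unit above `v`, `ψ_v` of conductor `𝒪_v`, `𝕋₀_v` integral (★ §7 of `K2LiuInertWeilSphericalLineFrame`), `U(𝒪_v)` fixes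
`1_{𝒪^{n′}}` (★ Ω1), `a` a unit above `v` (★ `eventually_valued_algebraMap_eq_one`), `v` GOOD for the doubled CM datum (★ `eventually_isGoodPlace_localComponent_inv`),
`θ` unramified above `v` (★ `HeckeCharacter.isUnramifiedAt_cofinite_holds`) — pulled back along ★ `tendsto_placesOver_cofinite`; united with the `S₀` of ★ `_of_upstairs`.

HONEST LABEL: HC_CM is proved only modulo the 7 printed citations (2 remaining named inputs: hLiu418 = stmt-HodgeConjecture-24832, h413 =
stmt-HodgeConjecture-24833) until rung 0 closes; this file pays ONE socket (#24i) of the U5e skeleton when tied, nothing more; count-neutral until the tie.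

## References
* [Liu2021] Y. Liu, Camb. J. Math. 9 (2021), Def. 4.11 (l. 2083–2097), App. D §D.1, Lem. D.1 (l. 5226–5233).
* [GelbartRogawski1991] S. Gelbart, J. Rogawski, Invent. Math. 105 (1991), §3 pp. 455–459.
* [CartierCorvallis1979] P. Cartier, PSPM 33.1 (1979), §IV.1.
* [MoeglinVignerasWaldspurger1987] C. Mœglin, M.-F. Vignéras, J.-L. Waldspurger, LNM 1291 (1987), Chap. 5 I.4, I.11.
* [TateThesis1967] J. Tate, in Cassels–Fröhlich (1967), §2.5, Lemma 3.2.1.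
-/

set_option autoImplicit false
set_option linter.dupNamespace false

noncomputable section

open scoped Matrix Kronecker TensorProduct Classical RestrictedProduct MatrixGroups
open NumberField IsDedekindDomain Filter Set MulAction MeasureTheory
open Literature.NumberTheory Literature.NumberTheory.Automorphic Literature.NumberTheory.Automorphic.UnitaryGroup
open Literature.NumberTheory.Automorphic.IdeleClassGroup Literature.NumberTheory.Automorphic.CartanUnique
open Literature.NumberTheory.GelbartRogawski1991 Literature.NumberTheory.GelbartRogawski1991.UnitaryDualPair
open Literature.NumberTheory.GelbartRogawski1991.UnitaryDualPair.WeilCoinv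
open Literature.NumberTheory.GelbartRogawski1991.UnitaryDualPair.LocalSplitting
open Literature.NumberTheory.GelbartRogawski1991.GRConstruction
open Literature.NumberTheory.Weil1964 Literature.RepresentationTheory
open Literature.RepresentationTheory.HeisenbergGroup
open Literature.NumberTheory.GaloisRepresentations Literature.RepresentationTheory.HarrisKudlaSweet1996
open Literature.NumberTheory.GaloisRepresentations.IsNonarchimedeanLocalField
open Literature.NumberTheory.Automorphic.Liu2021 Literature.NumberTheory.Automorphic.Liu2021.Def411WeilCarriers
open Literature.NumberTheory.Automorphic.Liu2021.Def411WeilCarriersDoubling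
open Literature.RepresentationTheory.Liu2021
open Summit.HodgeConjecture.HodgeConjecture.Cruxes.HLiu418.K2LiuInertWeilSphericalLine
open Summit.HodgeConjecture.HodgeConjecture.Cruxes.HLiu418.K2LiuThetaTypeInertGlobalAssembly
open Summit.HodgeConjecture.HodgeConjecture.Cruxes.HLiu418.K2LiuThetaTypeSphericalEigenvalueInertOfUpstairs
open Summit.HodgeConjecture.HodgeConjecture.Cruxes.HLiu418.K2LiuInertThetaSphericalEigenvalue

namespace Summit.HodgeConjecture.HodgeConjecture.Cruxes.HLiu418.K2LiuThetaTypeSphericalEigenvalueInert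

set_option maxHeartbeats 400000 in -- measured: > 200 000 (as ★ `hloc_inert_of_upstairs`): the `θ`-package place-`v` carrier under 30 binders; ONE instantiation each of ★ (L24-a) and ★ (Σ)
/-- **(Σ) AT ONE GOOD INERT PLACE, in the S4c-H carrier's currency.**  At a non-split unramified `w ∣ v` with #28i's frame∕generator block and the eight side
conditions (`2`, `imagUnit`, `ψ_v`, `𝕋₀_v`, Ω1, `a`, GOOD for the doubled CM datum, `θ` unramified at `w`), the upstairs Hecke operator `[U(𝒪_v) t₁ U(𝒪_v)]`
of `ω_v ∘ localLineInl v` (`ω_v` = the S4c-H place-`v` carrier at `θ = toHeckeCharacter L lam`) multiplies `1_{𝒪_v^{n′}}` by `q(Z + Z⁻¹) + q − 1`,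
`Z = θ.valueAtUniformizer w.1`: ★ (Σ) `heckeOperator_unitVec_eq_smul_inert` (its `hline` from (L24-a) ★ `fixedPoints_omegaLoc_comp_localLineInl_localInt_eq_span_unitVec_inert`),
transported along (β2) ★ `congrW_undoubledSplittings_cmFinLocalFamily_s` (+ `rfl`: `localSplittingCM = localSplittingCMWith … Measure.addHaar`) and (β1) ★
`HeckeCharacter.localComponent_eq_valueAtUniformizer`.
[cite: GelbartRogawski1991, §3.1 Prop. 3.1.1 p. 455, §3.2 (3.2.2) p. 457] [cite: TateThesis1967, §2.5] [cite: MoeglinVignerasWaldspurger1987, Chap. 5 I.11] -/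
theorem upstairs_inert_at (L : Type) [Field L] [NumberField L] [IsCMField L]
    (dV : Fin 2 → L) (hdV : ∀ i, IsCMField.complexConj L (dV i) = dV i) (hdV0 : ∀ i, dV i ≠ 0)
    {n' : ℕ} (e₁ : Fin 2 × Fin 1 ≃ Fin n')
    (lam : Literature.NumberTheory.Automorphic.IdeleClassGroup L →ₜ* Circle) (hlam : IsConjugateSymplectic L lam) (a : (Fp L)ˣ)
    (v : HeightOneSpectrum (𝓞 (Fp L))) (w : UnitaryGroup.PlacesOver L v) (hw : IsCMField.complexConj L • w.1 = w.1)
    (hv : Algebra.IsUnramifiedIn (𝓞 L) v.asIdeal)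
    {ϖ : w.1.adicCompletion L} (hϖ : Valued.v ϖ = WithZero.exp (-1 : ℤ))
    (hϖσ : galAdicCompletionMap (L := L) (IsCMField.complexConj L) hw ϖ = ϖ)
    (T : GL (Fin 2) (w.1.adicCompletion L)) (hTi : T ∈ glInt 2 (w.1.adicCompletion L))
    (hTJ : UnitaryGroup.placeForm (Matrix.diagonal dV) w.1 =
      formCongr (galAdicCompletionMap (L := L) (IsCMField.complexConj L) hw) T ((StdForm.antidiagonal 2).over (w.1.adicCompletion L)))
    (t₁ : UnitaryGroup.localPi L (IsCMField.complexConj L) 2 (Matrix.diagonal dV) v)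
    (ht₁ : (((t₁ : UnitaryGroup.LocalGLPi L 2 v) w : GL (Fin 2) (w.1.adicCompletion L)) : Matrix (Fin 2) (Fin 2) (w.1.adicCompletion L)) =
      ((T⁻¹ : GL (Fin 2) (w.1.adicCompletion L)) : Matrix (Fin 2) (Fin 2) (w.1.adicCompletion L)) *
        Matrix.diagonal ![ϖ, ϖ⁻¹] * (T : Matrix (Fin 2) (Fin 2) (w.1.adicCompletion L)))
    (g1 : Valued.v (2 : v.adicCompletion (Fp L)) = 1)
    (g2 : ∀ w' : UnitaryGroup.PlacesOver L v, Valued.v (algebraMap L (UnitaryGroup.LocalRing L v) (imagUnit L) w') = 1)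
    (g3 : (adeleAddCharAt (Fp L) v).HasConductorExp 0)
    (g4 : ∀ i k, localGram (Fp L) n' (gram (Fp L) e₁ (realDiagonal L dV hdV) (TW (Fp L) a)) v i k ∈ primePowBall (v.adicCompletion (Fp L)) 0)
    (g5 : unitVec (Fp L) (Fin n') v ∈ ((congrW L e₁ dV hdV (lineW L (TW (Fp L) a)) (complexConj_lineW L (TW (Fp L) a)) (realDiagonal_lineW L (TW (Fp L) a))
              (diagonal_lineW L (TW (Fp L) a) (JW_eq (Fp L) L a))
              (undoubledSplittings L e₁ dV hdV hdV0 (lineW L (TW (Fp L) a)) (complexConj_lineW L (TW (Fp L) a))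
                (lineW_ne_zero L (TW (Fp L) a) (isUnit_det_TW (Fp L) a)) (toHeckeCharacter L lam) (borelPlaceMeasure L)
                (cmFinLocalFamily L e₁ dV hdV hdV0 (lineW L (TW (Fp L) a)) (complexConj_lineW L (TW (Fp L) a))
                  (lineW_ne_zero L (TW (Fp L) a) (isUnit_det_TW (Fp L) a)) (toHeckeCharacter L lam)
                  ((isOscillatorChar_toHeckeCharacter_iff lam).mpr hlam) (borelPlaceMeasure L)))
              (isSymm_TW (Fp L) a) (JW_eq (Fp L) L a)).omegaLoc v).fixedPoints
        (UnitaryGroup.localInt L (IsCMField.complexConj L) n' (Matrix.reindex e₁ e₁ (Matrix.diagonal dV ⊗ₖ JW (Fp L) L a)) v))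
    (g6 : Valued.v (((algebraMap (Fp L) L (a : Fp L) : L) : w.1.adicCompletion L)) = 1)
    (g7 : IsGoodPlace (Fp L) L (imagUnit L) v n' (gram (Fp L) e₁ (realDiagonal L dV hdV) (TW (Fp L) a))
      (fun w' : UnitaryGroup.PlacesOver L v => ((toHeckeCharacter L lam).localComponent w'.1)⁻¹))
    (g8 : (toHeckeCharacter L lam).IsUnramifiedAt w.1) :
    heckeOperator (((congrW L e₁ dV hdV (lineW L (TW (Fp L) a)) (complexConj_lineW L (TW (Fp L) a)) (realDiagonal_lineW L (TW (Fp L) a))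
              (diagonal_lineW L (TW (Fp L) a) (JW_eq (Fp L) L a))
              (undoubledSplittings L e₁ dV hdV hdV0 (lineW L (TW (Fp L) a)) (complexConj_lineW L (TW (Fp L) a))
                (lineW_ne_zero L (TW (Fp L) a) (isUnit_det_TW (Fp L) a)) (toHeckeCharacter L lam) (borelPlaceMeasure L)
                (cmFinLocalFamily L e₁ dV hdV hdV0 (lineW L (TW (Fp L) a)) (complexConj_lineW L (TW (Fp L) a))
                  (lineW_ne_zero L (TW (Fp L) a) (isUnit_det_TW (Fp L) a)) (toHeckeCharacter L lam)
                  ((isOscillatorChar_toHeckeCharacter_iff lam).mpr hlam) (borelPlaceMeasure L)))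
              (isSymm_TW (Fp L) a) (JW_eq (Fp L) L a)).omegaLoc v).comp (localLineInl L (IsCMField.complexConj L) 2 e₁ (Matrix.diagonal dV) (JW (Fp L) L a) v))
        (UnitaryGroup.localInt L (IsCMField.complexConj L) 2 (Matrix.diagonal dV) v) t₁ (unitVec (Fp L) (Fin n') v) =
      ((v.residueCard : ℂ) *
                      ((toHeckeCharacter L lam).valueAtUniformizer w.1 + ((toHeckeCharacter L lam).valueAtUniformizer w.1)⁻¹) +
                    (v.residueCard : ℂ) - 1) • unitVec (Fp L) (Fin n') v := by
  classical
  letI : MeasurableSpace (v.adicCompletion (Fp L)) := borel _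
  haveI : BorelSpace (v.adicCompletion (Fp L)) := ⟨rfl⟩
  haveI : NeZero n' := ⟨(Fin.pos (e₁ (0, 0))).ne'⟩
  have hc : IsCMField.complexConj L ≠ 1 := IsCMField.complexConj_ne_one L
  have hJh : ((Matrix.reindex e₁ e₁ (Matrix.diagonal dV ⊗ₖ JW (Fp L) L a)).map (IsCMField.complexConj L))ᵀ =
      Matrix.reindex e₁ e₁ (Matrix.diagonal dV ⊗ₖ JW (Fp L) L a) := by
    rw [reindex_kronecker_eq_gram_map (Fp L) L e₁ (realDiagonal_map L dV hdV).symm (JW_eq (Fp L) L a)]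
    ext i k
    simp only [Matrix.transpose_apply, Matrix.map_apply, AlgEquiv.commutes]
    rw [(isSymm_gram (Fp L) e₁ (realDiagonal_isSymm L dV hdV) (isSymm_TW (Fp L) a)).apply i k]
  -- the `W`-scalar `a` read at `w`
  have hJW : UnitaryGroup.placeForm (JW (Fp L) L a) w.1 =
      Matrix.of fun _ _ : Fin 1 => ((algebraMap (Fp L) L (a : Fp L) : L) : w.1.adicCompletion L) := by
    refine Matrix.ext fun i k => ?_
    fin_cases i; fin_cases k
    simp only [UnitaryGroup.placeForm, JW_eq, TW, Matrix.map_apply, Matrix.of_apply, Matrix.cons_val', Matrix.cons_val_fin_one,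
      Matrix.empty_val', HeightOneSpectrum.algebraMap_adicCompletion, Function.comp_apply, Algebra.algebraMap_self, RingHom.id_apply]
  have hσa : galAdicCompletionMap (L := L) (IsCMField.complexConj L) hw
      ((algebraMap (Fp L) L (a : Fp L) : L) : w.1.adicCompletion L) = ((algebraMap (Fp L) L (a : Fp L) : L) : w.1.adicCompletion L) := by
    rw [galAdicCompletionMap_algebraMap]
  -- (β2): the S4c-H carrier at `v` IS `toRep ∘ localSplittingCMWith … Measure.addHaar`
  have hω : (congrW L e₁ dV hdV (lineW L (TW (Fp L) a)) (complexConj_lineW L (TW (Fp L) a)) (realDiagonal_lineW L (TW (Fp L) a))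
              (diagonal_lineW L (TW (Fp L) a) (JW_eq (Fp L) L a))
              (undoubledSplittings L e₁ dV hdV hdV0 (lineW L (TW (Fp L) a)) (complexConj_lineW L (TW (Fp L) a))
                (lineW_ne_zero L (TW (Fp L) a) (isUnit_det_TW (Fp L) a)) (toHeckeCharacter L lam) (borelPlaceMeasure L)
                (cmFinLocalFamily L e₁ dV hdV hdV0 (lineW L (TW (Fp L) a)) (complexConj_lineW L (TW (Fp L) a))
                  (lineW_ne_zero L (TW (Fp L) a) (isUnit_det_TW (Fp L) a)) (toHeckeCharacter L lam)
                  ((isOscillatorChar_toHeckeCharacter_iff lam).mpr hlam) (borelPlaceMeasure L)))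
              (isSymm_TW (Fp L) a) (JW_eq (Fp L) L a)).omegaLoc v =
      (MpPsi.toRep (localSchrodinger (Fp L) n' (gram (Fp L) e₁ (realDiagonal L dV hdV) (TW (Fp L) a)) v)).comp
        (localSplittingCMWith L n' (isSymm_gram (Fp L) e₁ (realDiagonal_isSymm L dV hdV) (isSymm_TW (Fp L) a))
            (isUnit_det_gram (Fp L) e₁ (isUnit_det_realDiagonal L dV hdV hdV0) (isUnit_det_TW (Fp L) a))
            (reindex_kronecker_eq_gram_map (Fp L) L e₁ (realDiagonal_map L dV hdV).symm (JW_eq (Fp L) L a)) (toHeckeCharacter L lam) ((isOscillatorChar_toHeckeCharacter_iff lam).mpr hlam) v Measure.addHaar) := by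
    rw [FinLocalSplittings.omegaLoc, congrW_undoubledSplittings_cmFinLocalFamily_s (hW'd := isUnit_det_TW (Fp L) a)]
    rfl
  -- (L24-a): the line `(ω_v ∘ localLineInl v)^{U(𝒪_v)} = ℂ ∙ 1`
  have hline := fixedPoints_omegaLoc_comp_localLineInl_localInt_eq_span_unitVec_inert (F := Fp L) L (IsCMField.complexConj L) hc e₁
    (Matrix.diagonal dV) (JW (Fp L) L a) (JW_apply_ne_zero (Fp L) L a) (complexConj_imagUnit L) (imagUnit_ne_zero L) (imagUnit_mul_self L)
    (gram (Fp L) e₁ (realDiagonal L dV hdV) (TW (Fp L) a)) (isSymm_gram (Fp L) e₁ (realDiagonal_isSymm L dV hdV) (isSymm_TW (Fp L) a))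
    (reindex_kronecker_eq_gram_map (Fp L) L e₁ (realDiagonal_map L dV hdV).symm (JW_eq (Fp L) L a)) hJh v w hw
    (congrW L e₁ dV hdV (lineW L (TW (Fp L) a)) (complexConj_lineW L (TW (Fp L) a)) (realDiagonal_lineW L (TW (Fp L) a))
              (diagonal_lineW L (TW (Fp L) a) (JW_eq (Fp L) L a))
              (undoubledSplittings L e₁ dV hdV hdV0 (lineW L (TW (Fp L) a)) (complexConj_lineW L (TW (Fp L) a))
                (lineW_ne_zero L (TW (Fp L) a) (isUnit_det_TW (Fp L) a)) (toHeckeCharacter L lam) (borelPlaceMeasure L)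
                (cmFinLocalFamily L e₁ dV hdV hdV0 (lineW L (TW (Fp L) a)) (complexConj_lineW L (TW (Fp L) a))
                  (lineW_ne_zero L (TW (Fp L) a) (isUnit_det_TW (Fp L) a)) (toHeckeCharacter L lam)
                  ((isOscillatorChar_toHeckeCharacter_iff lam).mpr hlam) (borelPlaceMeasure L)))
              (isSymm_TW (Fp L) a) (JW_eq (Fp L) L a))
    (isUnit_det_gram (Fp L) e₁ (isUnit_det_realDiagonal L dV hdV hdV0) (isUnit_det_TW (Fp L) a)) g1 g2 g3 g4 g5 _ hJW hσa g6 T hTi hTJ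
  rw [hω] at hline
  -- ★ (Σ) in `localSplittingCMWith`-currency, eigenvalue in `θ_w(ϖ)`-currency
  have hup := heckeOperator_unitVec_eq_smul_inert L dV v hdV hdV0 e₁ a Measure.addHaar (toHeckeCharacter L lam)
    ((isOscillatorChar_toHeckeCharacter_iff lam).mpr hlam) w hw hv hϖ hϖσ T hTi hTJ t₁ ht₁ g6 g7
    (fun f hf => by
      rw [hline] at hf
      obtain ⟨c, hc⟩ := Submodule.mem_span_singleton.1 hf
      exact ⟨c, hc.symm⟩)
  rw [hω, hup, HeckeCharacter.localComponent_eq_valueAtUniformizer (ϖ := Units.mk0 ϖ (uniformizer_ne_zero hϖ)) g8 hϖ]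

set_option maxHeartbeats 400000 in -- measured: > 200 000 (as ★ `thetaTypeSphericalEigenvalueInert_of_upstairs`): the `θ`-package carriers, 8 cofinite conditions
/-- **(Σ) DISCHARGED: the upstairs Hecke computation off a finite set of places**, in the shape of the hypothesis of ★ `thetaTypeSphericalEigenvalueInert_of_upstairs`:
the eight cofinite side conditions (★ §7 of `K2LiuInertWeilSphericalLineFrame`, ★ Ω1 `FinLocalSplittings.unitVec_mem_fixedPoints`, ★ `eventually_valued_algebraMap_eq_one`,
★ `eventually_isGoodPlace_localComponent_inv`, ★ `HeckeCharacter.isUnramifiedAt_cofinite_holds`) pulled back along ★ `tendsto_placesOver_cofinite`, then ★ `upstairs_inert_at`.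
[cite: GelbartRogawski1991, §3.1 (3.1.3) p. 456, §3.2 (3.2.2) p. 457] [cite: TateThesis1967, Lemma 3.2.1] -/
theorem upstairs_inert (L : Type) [Field L] [NumberField L] [IsCMField L]
    (dV : Fin 2 → L) (hdV : ∀ i, IsCMField.complexConj L (dV i) = dV i) (hdV0 : ∀ i, dV i ≠ 0)
    {n' : ℕ} (e₁ : Fin 2 × Fin 1 ≃ Fin n')
    (lam : Literature.NumberTheory.Automorphic.IdeleClassGroup L →ₜ* Circle) (hlam : IsConjugateSymplectic L lam) (a : (Fp L)ˣ) :
    ∃ S₂ : Set (HeightOneSpectrum (𝓞 L)), S₂.Finite ∧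
        ∀ (v : HeightOneSpectrum (𝓞 (Fp L))) (w : UnitaryGroup.PlacesOver L v), w.1 ∉ S₂ →
          ∀ (_hw : IsCMField.complexConj L • w.1 = w.1) (_hv : Algebra.IsUnramifiedIn (𝓞 L) v.asIdeal)
            (_h2 : ∀ w' : UnitaryGroup.PlacesOver L v, ValuativeRel.valuation (w'.1.adicCompletion L) (2 : w'.1.adicCompletion L) = 1)
            (_hdVw : ∀ (w' : UnitaryGroup.PlacesOver L v) (i : Fin 2),
              ValuativeRel.valuation (w'.1.adicCompletion L) (algebraMap L (w'.1.adicCompletion L) (dV i)) = 1)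
            (ϖ : w.1.adicCompletion L) (_hϖ : Valued.v ϖ = WithZero.exp (-1 : ℤ))
            (_hϖσ : galAdicCompletionMap (L := L) (IsCMField.complexConj L) _hw ϖ = ϖ)
            (T : GL (Fin 2) (w.1.adicCompletion L)) (_hTi : T ∈ glInt 2 (w.1.adicCompletion L))
            (_hTJ : UnitaryGroup.placeForm (Matrix.diagonal dV) w.1 =
              formCongr (galAdicCompletionMap (L := L) (IsCMField.complexConj L) _hw) T ((StdForm.antidiagonal 2).over (w.1.adicCompletion L)))
            (t₁ : UnitaryGroup.localPi L (IsCMField.complexConj L) 2 (Matrix.diagonal dV) v)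
            (_ht₁ : (((t₁ : UnitaryGroup.LocalGLPi L 2 v) w : GL (Fin 2) (w.1.adicCompletion L)) : Matrix (Fin 2) (Fin 2) (w.1.adicCompletion L)) =
              ((T⁻¹ : GL (Fin 2) (w.1.adicCompletion L)) : Matrix (Fin 2) (Fin 2) (w.1.adicCompletion L)) *
                Matrix.diagonal ![ϖ, ϖ⁻¹] * (T : Matrix (Fin 2) (Fin 2) (w.1.adicCompletion L))),
            heckeOperator (((congrW L e₁ dV hdV (lineW L (TW (Fp L) a)) (complexConj_lineW L (TW (Fp L) a)) (realDiagonal_lineW L (TW (Fp L) a))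
              (diagonal_lineW L (TW (Fp L) a) (JW_eq (Fp L) L a))
              (undoubledSplittings L e₁ dV hdV hdV0 (lineW L (TW (Fp L) a)) (complexConj_lineW L (TW (Fp L) a))
                (lineW_ne_zero L (TW (Fp L) a) (isUnit_det_TW (Fp L) a)) (toHeckeCharacter L lam) (borelPlaceMeasure L)
                (cmFinLocalFamily L e₁ dV hdV hdV0 (lineW L (TW (Fp L) a)) (complexConj_lineW L (TW (Fp L) a))
                  (lineW_ne_zero L (TW (Fp L) a) (isUnit_det_TW (Fp L) a)) (toHeckeCharacter L lam)
                  ((isOscillatorChar_toHeckeCharacter_iff lam).mpr hlam) (borelPlaceMeasure L)))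
              (isSymm_TW (Fp L) a) (JW_eq (Fp L) L a)).omegaLoc v).comp (localLineInl L (IsCMField.complexConj L) 2 e₁ (Matrix.diagonal dV) (JW (Fp L) L a) v))
                (UnitaryGroup.localInt L (IsCMField.complexConj L) 2 (Matrix.diagonal dV) v) t₁ (unitVec (Fp L) (Fin n') v) =
              ((v.residueCard : ℂ) *
                      ((toHeckeCharacter L lam).valueAtUniformizer w.1 + ((toHeckeCharacter L lam).valueAtUniformizer w.1)⁻¹) +
                    (v.residueCard : ℂ) - 1) • unitVec (Fp L) (Fin n') v := by
  classical
  haveI : NeZero n' := ⟨(Fin.pos (e₁ (0, 0))).ne'⟩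
  have hT₀d : IsUnit (gram (Fp L) e₁ (realDiagonal L dV hdV) (TW (Fp L) a)).det :=
    (isUnit_det_gram (Fp L) e₁ (isUnit_det_realDiagonal L dV hdV hdV0) (isUnit_det_TW (Fp L) a))
  have haL : (algebraMap (Fp L) L (a : Fp L) : L) ≠ 0 := (map_ne_zero _).2 a.ne_zero
  -- the cofinite side conditions, at the places of `L⁺` and then at the places of `L`
  have hgood : ∀ᶠ v : HeightOneSpectrum (𝓞 (Fp L)) in cofinite,
      Valued.v (2 : v.adicCompletion (Fp L)) = 1 ∧
      (∀ w' : UnitaryGroup.PlacesOver L v, Valued.v (algebraMap L (UnitaryGroup.LocalRing L v) (imagUnit L) w') = 1) ∧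
      (adeleAddCharAt (Fp L) v).HasConductorExp 0 ∧
      (∀ i k, localGram (Fp L) n' (gram (Fp L) e₁ (realDiagonal L dV hdV) (TW (Fp L) a)) v i k ∈ primePowBall (v.adicCompletion (Fp L)) 0) ∧
      unitVec (Fp L) (Fin n') v ∈ ((congrW L e₁ dV hdV (lineW L (TW (Fp L) a)) (complexConj_lineW L (TW (Fp L) a)) (realDiagonal_lineW L (TW (Fp L) a))
              (diagonal_lineW L (TW (Fp L) a) (JW_eq (Fp L) L a))
              (undoubledSplittings L e₁ dV hdV hdV0 (lineW L (TW (Fp L) a)) (complexConj_lineW L (TW (Fp L) a))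
                (lineW_ne_zero L (TW (Fp L) a) (isUnit_det_TW (Fp L) a)) (toHeckeCharacter L lam) (borelPlaceMeasure L)
                (cmFinLocalFamily L e₁ dV hdV hdV0 (lineW L (TW (Fp L) a)) (complexConj_lineW L (TW (Fp L) a))
                  (lineW_ne_zero L (TW (Fp L) a) (isUnit_det_TW (Fp L) a)) (toHeckeCharacter L lam)
                  ((isOscillatorChar_toHeckeCharacter_iff lam).mpr hlam) (borelPlaceMeasure L)))
              (isSymm_TW (Fp L) a) (JW_eq (Fp L) L a)).omegaLoc v).fixedPoints
          (UnitaryGroup.localInt L (IsCMField.complexConj L) n' (Matrix.reindex e₁ e₁ (Matrix.diagonal dV ⊗ₖ JW (Fp L) L a)) v) ∧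
      (∀ w' : UnitaryGroup.PlacesOver L v, Valued.v (algebraMap L (w'.1.adicCompletion L) (algebraMap (Fp L) L (a : Fp L))) = 1) ∧
      IsGoodPlace (Fp L) L (imagUnit L) v n' (gram (Fp L) e₁ (realDiagonal L dV hdV) (TW (Fp L) a))
        (fun w' : UnitaryGroup.PlacesOver L v => ((toHeckeCharacter L lam).localComponent w'.1)⁻¹) ∧
      (∀ w' : UnitaryGroup.PlacesOver L v, (toHeckeCharacter L lam).IsUnramifiedAt w'.1) := by
    filter_upwards [eventually_valued_two_eq_one' (Fp L), eventually_forall_valued_delta_eq_one (F := Fp L) L (imagUnit_ne_zero L),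
      eventually_hasConductorExp_zero_adeleAddCharAt (Fp L),
      eventually_forall_localGram_mem (F := Fp L) (gram (Fp L) e₁ (realDiagonal L dV hdV) (TW (Fp L) a)),
      ((congrW L e₁ dV hdV (lineW L (TW (Fp L) a)) (complexConj_lineW L (TW (Fp L) a)) (realDiagonal_lineW L (TW (Fp L) a))
              (diagonal_lineW L (TW (Fp L) a) (JW_eq (Fp L) L a))
              (undoubledSplittings L e₁ dV hdV hdV0 (lineW L (TW (Fp L) a)) (complexConj_lineW L (TW (Fp L) a))
                (lineW_ne_zero L (TW (Fp L) a) (isUnit_det_TW (Fp L) a)) (toHeckeCharacter L lam) (borelPlaceMeasure L)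
                (cmFinLocalFamily L e₁ dV hdV hdV0 (lineW L (TW (Fp L) a)) (complexConj_lineW L (TW (Fp L) a))
                  (lineW_ne_zero L (TW (Fp L) a) (isUnit_det_TW (Fp L) a)) (toHeckeCharacter L lam)
                  ((isOscillatorChar_toHeckeCharacter_iff lam).mpr hlam) (borelPlaceMeasure L)))
              (isSymm_TW (Fp L) a) (JW_eq (Fp L) L a))).unitVec_mem_fixedPoints,
      UnitaryGroup.eventually_forall_placesOver (F := Fp L) L (UnitaryGroup.eventually_valued_algebraMap_eq_one L haL),
      eventually_isGoodPlace_localComponent_inv L n' hT₀d (toHeckeCharacter L lam),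
      UnitaryGroup.eventually_forall_placesOver (F := Fp L) L (HeckeCharacter.isUnramifiedAt_cofinite_holds (toHeckeCharacter L lam))]
      with v h1 h2 h3 h4 h5 h6 h7 h8
    exact ⟨h1, h2, h3, h4, h5, h6, h7, h8⟩
  have hgoodL := (tendsto_placesOver_cofinite (Fp L) L).eventually hgood
  refine ⟨_, Filter.eventually_cofinite.1 hgoodL, ?_⟩
  intro v w hwS hw hv h2' hdVw ϖ hϖ hϖσ T hTi hTJ t₁ ht₁
  simp only [Set.mem_setOf_eq, not_not] at hwS
  rw [show placesOver (Fp L) L w.1 = v from w.2] at hwS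
  obtain ⟨g1, g2, g3, g4, g5, g6, g7, g8⟩ := hwS
  exact upstairs_inert_at L dV hdV hdV0 e₁ lam hlam a v w hw hv hϖ hϖσ T hTi hTJ t₁ ht₁ g1 g2 g3 g4 g5 (g6 w) g7 (g8 w)

/-- **SOCKET #24i `sig_K2LiuThetaTypeSphericalEigenvalueInert` — THE θ-TYPE SPHERICAL EIGENVALUE AT THE GOOD INERT PLACES, ON `σ`** (statement = the socket
:258–:302 VERBATIM): ★ `thetaTypeSphericalEigenvalueInert_of_upstairs` ∘ ★ `upstairs_inert`.
[cite: Liu2021, Def. 4.11 (l. 2083–2097); App. D Lem. D.1 (l. 5226–5233)] [cite: GelbartRogawski1991, §3 pp. 455–459] [cite: CartierCorvallis1979, §IV.1]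
[cite: MoeglinVignerasWaldspurger1987, Chap. 5 I.11] -/
theorem thetaTypeSphericalEigenvalueInert :
    ∀ (L : Type) [Field L] [NumberField L] [IsCMField L]
      (dV : Fin 2 → L) (hdV : ∀ i, IsCMField.complexConj L (dV i) = dV i) (hdV0 : ∀ i, dV i ≠ 0)
      -- ★ #30a's θ-type block at `H := Matrix.diagonal dV` (no `finAdelicCongr`)
      {n' : ℕ} (e₁ : Fin 2 × Fin 1 ≃ Fin n')
      (lam : Literature.NumberTheory.Automorphic.IdeleClassGroup L →ₜ* Circle) (hlam : IsConjugateSymplectic L lam)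
      (a : (↥(maximalRealSubfield L))ˣ) (χ : Chi (↥(maximalRealSubfield L)) L (IsCMField.complexConj L))
      (W : Type) [AddCommGroup W] [Module ℂ W]
      (σ : Representation ℂ (finAdelic (↥(maximalRealSubfield L)) L (IsCMField.complexConj L) 2 (Matrix.diagonal dV)) W)
      (j : σ.IntertwiningMap
        (rhoVAtLine (↥(maximalRealSubfield L)) L (IsCMField.complexConj L) 2 e₁ (Matrix.diagonal dV)
            (complexConj_imagUnit L) (imagUnit_ne_zero L) (imagUnit_mul_self L) (realDiagonal_isSymm L dV hdV)
            (isUnit_det_realDiagonal L dV hdV hdV0) (realDiagonal_map L dV hdV).symm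
            (fun a => isCompatible_chiSplittingLine L e₁ dV hdV hdV0 (toHeckeCharacter L lam)
              (isUnitary_toHeckeCharacter L lam) ((isOscillatorChar_toHeckeCharacter_iff lam).mpr hlam)
              (TW (↥(maximalRealSubfield L)) a) (isSymm_TW (↥(maximalRealSubfield L)) a)
              (isUnit_det_TW (↥(maximalRealSubfield L)) a) (JW (↥(maximalRealSubfield L)) L a)
              (JW_eq (↥(maximalRealSubfield L)) L a)) a χ)),
      Function.Injective j →
      ∃ S₀ : Set (HeightOneSpectrum (𝓞 L)), S₀.Finite ∧
        ∀ (v : HeightOneSpectrum (𝓞 (Fp L))) (w : UnitaryGroup.PlacesOver L v), w.1 ∉ S₀ →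
          -- #28i's place block: INERT, UNRAMIFIED, non-dyadic, of good reduction for `V`
          ∀ (_hw : IsCMField.complexConj L • w.1 = w.1) (_hv : Algebra.IsUnramifiedIn (𝓞 L) v.asIdeal)
            (_h2 : ∀ w' : UnitaryGroup.PlacesOver L v, ValuativeRel.valuation (w'.1.adicCompletion L) (2 : w'.1.adicCompletion L) = 1)
            (_hdVw : ∀ (w' : UnitaryGroup.PlacesOver L v) (i : Fin 2),
              ValuativeRel.valuation (w'.1.adicCompletion L) (algebraMap L (w'.1.adicCompletion L) (dV i)) = 1)
            -- #28i's frame∕generator block: a `σ_w`-fixed uniformizer, an integral hyperbolic frame of the place form, the ONE Hecke generator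
            (ϖ : w.1.adicCompletion L) (_hϖ : Valued.v ϖ = WithZero.exp (-1 : ℤ))
            (_hϖσ : galAdicCompletionMap (L := L) (IsCMField.complexConj L) _hw ϖ = ϖ)
            (T : GL (Fin 2) (w.1.adicCompletion L)) (_hTi : T ∈ glInt 2 (w.1.adicCompletion L))
            (_hTJ : UnitaryGroup.placeForm (Matrix.diagonal dV) w.1 =
              formCongr (galAdicCompletionMap (L := L) (IsCMField.complexConj L) _hw) T ((StdForm.antidiagonal 2).over (w.1.adicCompletion L)))
            (t₁ : UnitaryGroup.localPi L (IsCMField.complexConj L) 2 (Matrix.diagonal dV) v)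
            (_ht₁ : (((t₁ : UnitaryGroup.LocalGLPi L 2 v) w : GL (Fin 2) (w.1.adicCompletion L)) : Matrix (Fin 2) (Fin 2) (w.1.adicCompletion L)) =
              ((T⁻¹ : GL (Fin 2) (w.1.adicCompletion L)) : Matrix (Fin 2) (Fin 2) (w.1.adicCompletion L)) *
                Matrix.diagonal ![ϖ, ϖ⁻¹] * (T : Matrix (Fin 2) (Fin 2) (w.1.adicCompletion L)))
            -- ★ #30a∕#30b's level∕vector block, generic Hecke operator (★ `heckeTAt` is split-only)
            (K : Subgroup ↥(finAdelic ↥(maximalRealSubfield L) L (IsCMField.complexConj L) 2 (Matrix.diagonal dV))),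
            UnitaryGroup.IsHyperspecialAt ↥(maximalRealSubfield L) L (IsCMField.complexConj L) 2 (Matrix.diagonal dV) K v →
            ∀ y ∈ σ.fixedPoints K,
              heckeOperator σ K
                  (UnitaryGroup.inclPlace ↥(maximalRealSubfield L) L (IsCMField.complexConj L) 2 (Matrix.diagonal dV) v t₁) y =
                ((v.residueCard : ℂ) *
                      ((toHeckeCharacter L lam).valueAtUniformizer w.1 + ((toHeckeCharacter L lam).valueAtUniformizer w.1)⁻¹) +
                    (v.residueCard : ℂ) - 1) • y :=
  fun L _ _ _ dV hdV hdV0 _ e₁ lam hlam a χ W _ _ σ j hj =>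
    thetaTypeSphericalEigenvalueInert_of_upstairs L dV hdV hdV0 e₁ lam hlam a χ W σ j hj (upstairs_inert L dV hdV hdV0 e₁ lam hlam a)

end Summit.HodgeConjecture.HodgeConjecture.Cruxes.HLiu418.K2LiuThetaTypeSphericalEigenvalueInert

end
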